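import Summits.AtomisticToContinuum.Crystallization.Theorems.ExcessDecayLiouvilleHcpLiouvilleBlowdownCaccioppoliOwn
import Summits.AtomisticToContinuum.Crystallization.Theorems.ExcessDecayLiouvilleHcpLiouvilleCoreOfCaccioppoli
import Summits.AtomisticToContinuum.Crystallization.Theorems.ExcessDecayLiouvilleHcpLiouvilleAnchoredLiouville

/-!
# `ExcessDecayLiouville.HcpLiouville` (stmt-AtomisticToContinuum-9332): the crux modulo its certified-computation inputs — both compositions of line `Sketch` v5.3

Two registered sub-goals recording, as sorry-free conditional theorems, exactly what the crux is reduced to after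
waves 1–2 of lead c2 (every analytic step landed):

* `hcpLiouville_of_ownSecant` (composition A′): the relaxed inner shift of every admissible cell (certified
  computation; proved exactly on the uniaxial family, p153218) and OWN-FIELD weighted ray-secant coercivity from relaxed
  anchors at anchor radius `1/20` (certified computation — the single instance the Caccioppoli step consumes) imply
  `HcpLiouville`.  Chain: `stub_caccioppoli_own` (p154643) → `stub_core_of_caccioppoli` (p154839) → `Iff.rfl`.
* `hcpLiouville_of_anchoredBox_of_anchoring` (composition B): tangent box coercivity at vertex radius `1/40` about
  equilibrium data (certified computation) and equilibrium anchoring (the open core: every `X` of the crux's hypothesis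
  class is globally `1/40`-matched with an admissible hcp-like EQUILIBRIUM datum) imply `HcpLiouville`.  Chain:
  `anchoredLiouville_of_box` (p153926) + pure-logic glue.

All `[folklore]`; `--supports` helpers for item stmt-AtomisticToContinuum-9332; the item closes only when the named
inputs are discharged.
-/

noncomputable section

namespace Summit.AtomisticToContinuum.Crystallization.Theorems.ExcessDecayLiouville

open scoped BigOperators Topology Classical InnerProductSpace
open Literature.MathematicalPhysics.StatisticalMechanics
open Summit.AtomisticToContinuum.Crystallization.Theses.ExcessDecayLiouville
open Summit.AtomisticToContinuum.Crystallization.Theorems.PhononStabilityNegative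

local notation "E3" => EuclideanSpace ℝ (Fin 3)

/-- **Composition A′ of line `Sketch`** (registered sub-goal of crux stmt-AtomisticToContinuum-9332): the relaxed inner
shift of every admissible cell and own-field weighted ray-secant coercivity from relaxed anchors at anchor radius `1/20`
(constant `κ₁ > 0`, test fields `χ_{c,R} • (v − m)`, `1 ≤ R`, `‖m‖ ≤ 1`) imply the crux `HcpLiouville` — the whole
blow-down (one particle per site, anchor, Caccioppoli, exact linearised equation and remainder bound, lattice Green's
operator, interior decay, improvement, iteration from `R = ∞`) is landed. [folklore] -/
theorem hcpLiouville_of_ownSecant :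
    (∀ (A : E3 →L[ℝ] E3), Adm₀ A →
      ∃ e : E3, ‖e - A (barlowOffset 1 + layerNormal (Real.sqrt (2 / 3)))‖ ≤ 1 / 40 ∧
        HasSum (fun z : Λ₀ => (deriv lennardJones ‖e + A z‖ / ‖e + A z‖) • (e + A z)) 0) →
    (∃ κ₁ : ℝ, 0 < κ₁ ∧
      ∀ (t : Fin 2 → E3) (A : E3 →L[ℝ] E3) (τ : E3), Adm₀ A → Inner₀ t A → ‖τ‖ ≤ 1 / 20 →
        Inner₀ (anchorDatum t τ) A → Equil₀ (Sites₀ (anchorDatum t τ) A) →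
        ∀ v : E3 → E3, (∀ s ∈ Sites₀ (anchorDatum t τ) A, ‖v s + shiftField (anchorDatum t τ) A τ s‖ ≤ 1 / 40) →
          ∀ (c : E3) (R : ℝ) (m : E3), 1 ≤ R → ‖m‖ ≤ 1 →
            κ₁ * nnForm (anchorDatum t τ) A
                (fun p => LevelOne.cutoff (Sites₀ (anchorDatum t τ) A) c R p • (v p - m)) ≤
              secFormAt (anchorDatum t τ) A v
                (fun p => LevelOne.cutoff (Sites₀ (anchorDatum t τ) A) c R p • (v p - m)) / 2) →
    HcpLiouville := by
  intro hRS hown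
  obtain ⟨κ₁, hκ₁, h⟩ := hown
  exact stub_core_of_caccioppoli hRS (stub_caccioppoli_own κ₁ hκ₁ h)

/-- **Composition B of line `Sketch`** (registered sub-goal of crux stmt-AtomisticToContinuum-9332): tangent box
coercivity at vertex radius `1/40` about equilibrium data (constant `κ > 0`) and EQUILIBRIUM ANCHORING (under the crux's
hypotheses `X` is globally two-way `1/40`-matched with some admissible hcp-like datum whose site set is in force balance)
imply the crux `HcpLiouville` — re-anchor, then `anchoredLiouville_of_box`. [folklore] -/
theorem hcpLiouville_of_anchoredBox_of_anchoring :
    (∃ κ : ℝ, 0 < κ ∧ ∀ (t : Fin 2 → E3) (A : E3 →L[ℝ] E3), Adm₀ A → Inner₀ t A → Equil₀ (Sites₀ t A) →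
      ∀ w : E3 → E3, (∀ s ∈ Sites₀ t A, ‖w s‖ ≤ 1 / 40) →
        ∀ φ : E3 → E3, (Function.support φ).Finite → Function.support φ ⊆ Sites₀ t A →
          κ * nnForm t A φ ≤ hessFormAt t A w φ / 2) →
    (PhononStability → ∀ δ : ℝ, 0 < δ → ∀ X : Set E3, Sep₀ X δ → Equil₀ X →
      ∀ (t : Fin 2 → E3) (A : E3 →L[ℝ] E3), Adm₀ A → Inner₀ t A →
        (∀ (c : E3) (r : ℝ), Near₀ X c r t A (1 / 40)) →
          ∃ (t'' : Fin 2 → E3) (A'' : E3 →L[ℝ] E3), Adm₀ A'' ∧ Inner₀ t'' A'' ∧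
            Equil₀ (Sites₀ t'' A'') ∧ ∀ (c : E3) (r : ℝ), Near₀ X c r t'' A'' (1 / 40)) →
    HcpLiouville := by
  intro hbox hEA
  obtain ⟨κ, hκ, hb⟩ := hbox
  show PhononStability → ∀ δ : ℝ, 0 < δ → ∀ X : Set E3, Sep₀ X δ → Equil₀ X →
      ∀ (t : Fin 2 → E3) (A : E3 →L[ℝ] E3), Adm₀ A → Inner₀ t A →
        (∀ (c : E3) (r : ℝ), Near₀ X c r t A (1 / 40)) →
          ∃ (t' : Fin 2 → E3) (A' : E3 →L[ℝ] E3), Adm₀ A' ∧ X = Sites₀ t' A'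
  intro hPS δ hδ X hSep hEq t A hA hI hN
  obtain ⟨t'', A'', hA'', hI'', hE'', hN''⟩ := hEA hPS δ hδ X hSep hEq t A hA hI hN
  exact anchoredLiouville_of_box κ hκ hb hPS δ hδ X hSep hEq t'' A'' hA'' hI'' hE'' hN''

end Summit.AtomisticToContinuum.Crystallization.Theorems.ExcessDecayLiouville

end
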